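import Summits.ResolutionOfSingularities.ResolutionOfSingularities.Theorems.MarkedTransferCampaignW46FiniteExitBoundAssembly
import Summits.ResolutionOfSingularities.ResolutionOfSingularities.Theorems.MarkedTransferCampaignW46FiniteExitBoundEssFiniteType
import Summits.ResolutionOfSingularities.ResolutionOfSingularities.Theorems.MarkedTransferCampaignW46ExitTreeNoBranch
import Summits.ResolutionOfSingularities.ResolutionOfSingularities.Theorems.MarkedTransferCampaignW46IsolatedThreadExitBound
import Literature.AlgebraicGeometry.Resolution.IntegralClosureEssFiniteType
import HarnessLib

/-!
# [OURS · L1 W4.6 rung (i-a)′ / (i-a)] CLOSER: `PlaneIsolatedFinLocalExitBound p K` holds, and the rung in all its forms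
# (cell res-hironaka, LADDER-RESOLUTION rung L, D-0089; campaign s46, seat res-D-pv-046 AS res-L1-s46-pv-9; host route MarkedTransfer,
# `--supports stmt-ResolutionOfSingularities-16156 --as helper`)

HONEST FRAMING. Nothing here is a statement of H. Hironaka's manuscript (2017-03-23, [Hironaka2017]); the rung is a CLASSICAL
calibration statement (embedded order reduction for curves on a smooth surface over a field of characteristic `p > 0`, at an
isolated point of the singular locus, terminates along every permissible run: Zariski 1939 / Abhyankar 1956 / Lipman 1978 territory),
here closed by composing three kernel-checked layers of campaign s46:

* the RUN / GLUE / DICTIONARY / ASSEMBLY layers of this seat (`planeIsolatedFinLocalExitBound_of_noInfiniteMarkedBranchAt`,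
  p497699 … p505617): the rung follows from **Theorem A at the root germs** — no infinite chain of marked steps (two-dimensional
  quadratic transforms with controlled transforms of order in `[b, 2b)`) out of the tame isolated node
  `⟨𝒪_{Z,ξ} ⊂ K(Z), J_ξ⟩` of a closed point `ξ` of a regime ambient surface;
* **Theorem A** of res-D-pv-044 AS res-L1-s46-pv-8 (`no_infinite_markedChain`, `MarkedTransferCampaignW46ExitTreeNoBranch`,
  Zariski–Abhyankar: principalization along the chain, monomialization of the principal generator along the valuation of the
  chain, monomial descent), stated for `K : Type` with ONE root hypothesis beyond isolation: every one-dimensional prime quotient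
  `S ⧸ 𝔮` of the root ring is N-1 (finite normalisation);
* the discharge of that hypothesis at the root germs (this file): `𝒪_{Z,ξ}` is essentially of finite type over the base field
  (`exists_essFiniteType_range_stalk`, p506222), hence so is every quotient `𝒪_{Z,ξ} ⧸ 𝔮`, and a domain essentially of finite
  type over a field has finite normalisation (tree `module_finite_integralClosure_of_essFiniteType`, E. Noether / Liu 2002
  Prop. 4.1.27 / Stacks 0307).

Main results (all for `K : Type`, the universe of the host item `Scheme.{0}`):
* `module_finite_integralClosure_quotient_of_essFiniteType` — prime quotients of a ring essentially of finite type over a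
  field are N-1;
* `planeIsolatedFinLocalExitBound_holds : PlaneIsolatedFinLocalExitBound p K` — **rung (i-a)′ CLOSED**;
* `planeIsolatedTerminates_holds : PlaneIsolatedPermissiblyTerminates p K ∧ PlaneIsolatedTerminates p K ∧
  PlaneIsolatedTerminatesNabla p K` — **rung (i-a) in all its typed forms** (résumé-free termination on surfaces with isolated
  singular point along every permissible run; the literal-centre and the ∇-centred typed rungs for every notion instance);
* (v2, pure append) `planeIsolatedLocalExitBound_holds : PlaneIsolatedLocalExitBound p K` and
  `planeIsolatedNoHitThread_holds : PlaneIsolatedNoHitThread p K` — the two remaining NAMED forms of the rung (the infinite-run local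
  exit bound, `localExitBound_of_finLocalExitBound`; res-L1-s46-pv-1's thread form, `planeIsolatedNoHitThread_of_localExitBound`), so
  that every named `Prop` of the (i-a) family is closed by name.

AI review is weaker than expert review. No `sorry`; axioms standard.

## References
* O. Zariski, P. Samuel, *Commutative Algebra* II (1960), Appendix 5. [ZariskiSamuel1960]
* S. S. Abhyankar, *On the valuations centered in a local domain*, Amer. J. Math. 78 (1956). [Abhyankar1956Valuations]
* Q. Liu, *Algebraic Geometry and Arithmetic Curves* (2002), Prop. 4.1.27. [Liu2002]
-/

noncomputable section

set_option linter.dupNamespace false -- mandated namespace of this single-conjunct summit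

open CategoryTheory AlgebraicGeometry TopologicalSpace IsLocalRing

namespace Summit.ResolutionOfSingularities.ResolutionOfSingularities.Theorems

namespace CampaignW46

open Literature.AlgebraicGeometry.Resolution
open Literature.AlgebraicGeometry.Hironaka2017.S02Preliminaries

/-! ## Prime quotients of rings essentially of finite type over a field are N-1 -/

/-- **Prime quotients of a ring essentially of finite type over a field have finite normalisation**: if `φ : k → R` is
essentially of finite type (`k` a field) and `𝔮 ⊂ R` is prime, then for every fraction field `L` of `R ⧸ 𝔮` the integral
closure of `R ⧸ 𝔮` in `L` is a finite `R ⧸ 𝔮`-module (`R ⧸ 𝔮` is again essentially of finite type over `k`; E. Noether's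
finiteness theorem and localisation, tree `module_finite_integralClosure_of_essFiniteType`).
[cite: Liu2002, Prop. 4.1.27, p. 122] -/
theorem module_finite_integralClosure_quotient_of_essFiniteType {k R : Type} [Field k] [CommRing R]
    (φ : k →+* R) (hφ : φ.EssFiniteType) (𝔮 : Ideal R) [𝔮.IsPrime]
    (L : Type) [Field L] [Algebra (R ⧸ 𝔮) L] [IsFractionRing (R ⧸ 𝔮) L] :
    Module.Finite (R ⧸ 𝔮) (integralClosure (R ⧸ 𝔮) L) := by
  have hq : ((Ideal.Quotient.mk 𝔮).comp φ).EssFiniteType :=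
    RingHom.EssFiniteType.comp hφ
      (RingHom.FiniteType.of_surjective (Ideal.Quotient.mk 𝔮) Ideal.Quotient.mk_surjective).essFiniteType
  letI : Algebra k (R ⧸ 𝔮) := ((Ideal.Quotient.mk 𝔮).comp φ).toAlgebra
  haveI : Algebra.EssFiniteType k (R ⧸ 𝔮) := hq
  exact module_finite_integralClosure_of_essFiniteType k (R ⧸ 𝔮) L

/-- The same at the ROOT RING of the marked quadratic tree of an ambient datum over `K : Type`: every prime quotient of
`(𝒪_{Z,ξ} → K(Z)).range ≅ 𝒪_{Z,ξ}` is N-1 — the root hypothesis `hfin` of Theorem A (`no_infinite_markedChain`). [folklore] -/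
theorem module_finite_integralClosure_quotient_range_stalk {p : ℕ} [Fact p.Prime] {K : Type} [Field K] [CharP K p]
    (A : AmbientDatum p K) (ξ : A.Z) :
    haveI := ambient_isIntegral A
    ∀ (𝔮 : Ideal (algebraMap (A.Z.presheaf.stalk ξ) A.Z.functionField).range) (L : Type) [Field L]
      [Algebra ((algebraMap (A.Z.presheaf.stalk ξ) A.Z.functionField).range ⧸ 𝔮) L]
      [IsFractionRing ((algebraMap (A.Z.presheaf.stalk ξ) A.Z.functionField).range ⧸ 𝔮) L],
      𝔮.IsPrime → ringKrullDim ((algebraMap (A.Z.presheaf.stalk ξ) A.Z.functionField).range ⧸ 𝔮) = 1 →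
        Module.Finite ((algebraMap (A.Z.presheaf.stalk ξ) A.Z.functionField).range ⧸ 𝔮)
          (integralClosure ((algebraMap (A.Z.presheaf.stalk ξ) A.Z.functionField).range ⧸ 𝔮) L) := by
  haveI := ambient_isIntegral A
  intro 𝔮 L _ _ _ h𝔮 _
  obtain ⟨φ, hφ⟩ := exists_essFiniteType_range_stalk A ξ
  exact module_finite_integralClosure_quotient_of_essFiniteType φ hφ 𝔮 L

/-! ## The closer -/

/-- **RUNG (i-a)′ CLOSED: `PlaneIsolatedFinLocalExitBound p K` holds** (for every prime `p` and every field `K : Type` of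
characteristic `p`): along every permissible run of the hypersurface order-reduction procedure on a regime ambient surface whose
singular locus is the isolated closed point `x`, the number of stages whose centre meets the fibre over `x` is bounded by the exit
count `ν(𝒪_{Z,x}, J_x, b)` of the marked quadratic tree above `x`. Composition of `planeIsolatedFinLocalExitBound_of_noInfiniteMarkedBranchAt`
(this seat's assembly) with Theorem A `no_infinite_markedChain` (res-L1-s46-pv-8) at the root germs, whose N-1 hypothesis is
`module_finite_integralClosure_quotient_range_stalk`. [cite: ZariskiSamuel1960, Appendix 5] -/
theorem planeIsolatedFinLocalExitBound_holds (p : ℕ) [Fact p.Prime] (K : Type) [Field K] [CharP K p] :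
    PlaneIsolatedFinLocalExitBound p K :=
  planeIsolatedFinLocalExitBound_of_noInfiniteMarkedBranchAt (p := p) (K := K)
    fun A ξ _ _ b I _ hiso c hc hstep => by
      haveI := ambient_isIntegral A
      exact no_infinite_markedChain hiso (module_finite_integralClosure_quotient_range_stalk A ξ) c hc hstep

/-- **RUNG (i-a) IN ALL ITS FORMS**: résumé-free termination of every permissible run on regime ambient surfaces with isolated
singular point (`PlaneIsolatedPermissiblyTerminates`), and the typed rungs for every notion instance — literal centres
(`PlaneIsolatedTerminates`) and ∇-centred (`PlaneIsolatedTerminatesNabla`). [cite: ZariskiSamuel1960, Appendix 5] -/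
theorem planeIsolatedTerminates_holds (p : ℕ) [Fact p.Prime] (K : Type) [Field K] [CharP K p] :
    PlaneIsolatedPermissiblyTerminates p K ∧ PlaneIsolatedTerminates p K ∧ PlaneIsolatedTerminatesNabla p K :=
  have h := planeIsolatedFinLocalExitBound_holds p K
  ⟨planeIsolatedPermissiblyTerminates_of_finLocalExitBound h, planeIsolatedTerminatesNabla_of_finLocalExitBound h⟩

/-! ## v2 (pure append): the remaining named forms of the rung -/

/-- **The infinite-run local exit bound on surfaces with isolated singular point** (`PlaneIsolatedLocalExitBound`, the named
form of `MarkedTransferCampaignW46PlaneIsolated`): from rung (i-a)′ by truncation (`localExitBound_of_finLocalExitBound`).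
[cite: ZariskiSamuel1960, Appendix 5] -/
theorem planeIsolatedLocalExitBound_holds (p : ℕ) [Fact p.Prime] (K : Type) [Field K] [CharP K p] :
    PlaneIsolatedLocalExitBound p K :=
  localExitBound_of_finLocalExitBound (planeIsolatedFinLocalExitBound_holds p K)

/-- **No hit thread on surfaces with isolated singular point** (`PlaneIsolatedNoHitThread`, res-L1-s46-pv-1's local/thread form
of rung (i-a), `MarkedTransferCampaignW46IsolatedThread`): along a permissible run in the regime no chain of infinitely near
singular points is blown up infinitely often — from the local exit bound by `planeIsolatedNoHitThread_of_localExitBound`.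
[cite: ZariskiSamuel1960, Appendix 5] -/
theorem planeIsolatedNoHitThread_holds (p : ℕ) [Fact p.Prime] (K : Type) [Field K] [CharP K p] :
    PlaneIsolatedNoHitThread p K :=
  planeIsolatedNoHitThread_of_localExitBound (planeIsolatedLocalExitBound_holds p K)

end CampaignW46

end Summit.ResolutionOfSingularities.ResolutionOfSingularities.Theorems

end
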